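import Literature.Probability.RandomPlanarGeometry.StarHullOneStepClean
import HarnessLib

/-!
# The one-step expansion of `Y = Φ'_B(0)^α` for a general exponent `α > 0` ([LSW] Prop. 5.3, deterministic part)

General-exponent twin of `StarHullOneStep` / `StarHullOneStepClean` (which treat `Y = d^{5/8}`,
the case `κ = 8/3` of [LSW] Prop. 5.2), after

* G. F. Lawler, O. Schramm, W. Werner, *Conformal restriction: the chordal case*, J. Amer. Math.
  Soc. **16** (2003) 917–955, arXiv:math/0209343 (**[LSW]**), §5 (5.2)–(5.3) and Prop. 5.3:
  for `W_t = √κ B_t`, `α = (6 − κ)/(2κ)`, `λ = (8 − 3κ)(6 − κ)/(2κ)`,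
  "`Y_t = h_t′(W_t)^α exp(λ ∫₀ᵗ Sh_s(W_s)/6 ds)`, `t < T`, is a local martingale";
* G. F. Lawler, *Conformally Invariant Processes in the Plane* (2005), §4.6.1 (4.37).

For a `*`-hull `B` (canonical data `d = starDeriv B`, jets `c₂ = E″(0) = starJet2 B`,
`c₃ = E‴(0) = starJet3 B`) and one step of the Loewner flow with increment driver `U` run for time
`u` (`B′ = slidHull U B u`, `x = U_u`, `η = stepSize S u`), the deterministic expansion
`d′ − d = c₂ x + c₃ x²/2 + u (c₂²/(2d) − (4/3) c₃) + O(…)` of `StarHullOneStep`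
(`abs_starDeriv_sub_model_le`) is combined with the Taylor expansion of `y ↦ y^α` to second order:

* `Literature.Probability.RandomPlanarGeometry.abs_rpow_sub_taylor_le_gen` — for every real `α`,
  `0 < d`, `|Δ| ≤ d/2`: `|(d+Δ)^α − d^α − α d^{α−1} Δ − α(α−1) d^{α−2} Δ²/2| ≤ taylorK α d · |Δ|³`
  with the explicit `taylorK α d = |α(α−1)(α−2)| ((d/2)^{α−3} + (3d/2)^{α−3})`;
* `Literature.Probability.RandomPlanarGeometry.Loewner.stepModelK α d c₂ c₃ u x` — the linear
  model `α d^{α−1} (c₂ x + c₃ x²/2 + u (c₂²/(2d) − (4/3)c₃)) + ½ α(α−1) d^{α−2} c₂² x²` of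
  `Y′ − Y`, `Y = d^α` (`stepModel` of `StarHullOneStep` is the case `α = 5/8`,
  `stepModelK_five_eighths`); replacing `x²` by `κ u` and dropping the term linear in `x` leaves
  `u · [α d^{α−1}((κ/2 − 4/3) c₃ + c₂²/(2d)) + ½ α(α−1) d^{α−2} κ c₂²]` (`stepModelK_eq`), the drift
  of [LSW] (5.3) — equal to `driftCoeffK κ α d c₂ c₃` of `SLEBubblesSchwarzianMass`, which at
  `α = α_κ` is `λ_κ · (−SE(0)/6) · d^α` (Prop. 5.3);
* `Literature.Probability.RandomPlanarGeometry.Loewner.abs_rpowK_sub_stepModelK_le_of`,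
  `…abs_rpowK_sub_stepModelK_le`, **`…abs_rpowK_sub_stepModelK_le_clean`** — for `α > 0`:
  `|Y′ − Y − stepModelK| ≤ ratioK α δ₀ · stepKcleanOf δ₀ (stepK δ₀ ρ₀) · (u η + u² + |x|³ + u |x|)`
  on the controlled class (`δ₀ ≤ Φ′_B(0)`, `B` off `B(0, 8ρ₀)`, `ρ₀ ≤ 1`, `u, η ≤ 1`), the three
  prefactors `taylorK α d`, `α d^{α−1}`, `|α(α−1)| d^{α−2}/2` being at most `ratioK α δ₀` times
  those of the case `α = 5/8` (`ratioK_spec`), so that the algebraic domination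
  `stepModel_rhs_le` of `StarHullOneStepClean` applies verbatim.

This is the deterministic input of the conditional-increment proof of the martingale property of
`h_t′(W_t)^α exp(−λ ∫₀ᵗ m)` for `0 < κ < 8/3` ([LSW] Thm. 6.5), as `StarHullOneStep*` is for
`κ = 8/3` (`SLERestrictionOneStep`, `SLERestrictionIncrement`).

## References

* [LSW] §5 (5.2)–(5.3), Prop. 5.3. [LawlerSchrammWerner2003Restriction]
* Lawler (2005), §4.6.1 (4.35)–(4.37). [Lawler2005]
-/

noncomputable section

open Set Filter Metric Function
open _root_.Complex _root_.Topology _root_.Real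
open UpperHalfPlane (upperHalfPlaneSet)
open scoped NNReal

namespace Literature.Probability.RandomPlanarGeometry

/-! ### Taylor expansion of `y ↦ y^α` to second order, any real `α` -/

/-- The Taylor constant: `taylorK α d = |α(α−1)(α−2)| ((d/2)^{α−3} + (3d/2)^{α−3})` bounds
`|f‴|`, `f(y) = y^α`, on `[d/2, 3d/2]` (`y^{α−3}` is monotone there, either way). [folklore] -/
def taylorK (α d : ℝ) : ℝ :=
  |α * (α - 1) * (α - 2)| * ((d / 2) ^ (α - 3) + (3 * d / 2) ^ (α - 3))

/-- `0 ≤ taylorK α d` for `d > 0`. [folklore] -/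
theorem taylorK_nonneg (α : ℝ) {d : ℝ} (hd : 0 < d) : 0 ≤ taylorK α d := by
  unfold taylorK
  have h1 : 0 ≤ (d / 2) ^ (α - 3) := Real.rpow_nonneg (by positivity) _
  have h2 : 0 ≤ (3 * d / 2) ^ (α - 3) := Real.rpow_nonneg (by positivity) _
  positivity

/-- A power `y^e` on `[d/2, 3d/2]` is at most `(d/2)^e + (3d/2)^e` (monotone in `y`, whichever
way). [folklore] -/
theorem rpow_le_endpoints {d y e : ℝ} (hd : 0 < d) (hy1 : d / 2 ≤ y) (hy2 : y ≤ 3 * d / 2) :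
    y ^ e ≤ (d / 2) ^ e + (3 * d / 2) ^ e := by
  have h1 : 0 ≤ (d / 2) ^ e := Real.rpow_nonneg (by positivity) _
  have h2 : 0 ≤ (3 * d / 2) ^ e := Real.rpow_nonneg (by positivity) _
  rcases le_or_gt 0 e with he | he
  · have : y ^ e ≤ (3 * d / 2) ^ e := Real.rpow_le_rpow (by linarith) hy2 he
    linarith
  · have : y ^ e ≤ (d / 2) ^ e := Real.rpow_le_rpow_of_nonpos (by positivity) hy1 he.le
    linarith

/-- **Second-order Taylor bound for `f(y) = y^α` on `[d/2, 3d/2]`**, any real `α`: for `0 < d`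
and `|Δ| ≤ d/2`,
`|f(d + Δ) − f(d) − f′(d) Δ − f″(d) Δ²/2| ≤ taylorK α d · |Δ|³` with `f′(d) = α d^{α−1}`,
`f″(d) = α(α−1) d^{α−2}` (mean value inequality three times, as in `abs_rpow_sub_taylor_le`).
[folklore] -/
theorem abs_rpow_sub_taylor_le_gen (α : ℝ) {d Δ : ℝ} (hd : 0 < d) (hΔ : |Δ| ≤ d / 2) :
    |(d + Δ) ^ α - d ^ α - α * d ^ (α - 1) * Δ - α * (α - 1) * d ^ (α - 2) * Δ ^ 2 / 2| ≤
      taylorK α d * |Δ| ^ 3 := by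
  -- the segment `s = [d - |Δ|, d + |Δ|] ⊆ [d/2, 3d/2]`
  set s : Set ℝ := Icc (d - |Δ|) (d + |Δ|) with hs
  have hsconv : Convex ℝ s := convex_Icc _ _
  have hds : d ∈ s := ⟨by linarith [abs_nonneg Δ], by linarith [abs_nonneg Δ]⟩
  have hdΔs : d + Δ ∈ s := ⟨by linarith [neg_abs_le Δ], by linarith [le_abs_self Δ]⟩
  have hspos : ∀ y ∈ s, d / 2 ≤ y ∧ y ≤ 3 * d / 2 ∧ 0 < y := fun y hy ↦
    ⟨by linarith [hy.1], by linarith [hy.2], by linarith [hy.1]⟩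
  -- the derivatives
  set f : ℝ → ℝ := fun y ↦ y ^ α with hf
  set f₁ : ℝ → ℝ := fun y ↦ α * y ^ (α - 1) with hf₁
  set f₂ : ℝ → ℝ := fun y ↦ α * (α - 1) * y ^ (α - 2) with hf₂
  set f₃ : ℝ → ℝ := fun y ↦ α * (α - 1) * (α - 2) * y ^ (α - 3) with hf₃
  have hd0 : ∀ y ∈ s, HasDerivAt f (f₁ y) y := fun y hy ↦ by
    have := Real.hasDerivAt_rpow_const (p := α) (x := y) (Or.inl (hspos y hy).2.2.ne')
    exact this
  have hd1 : ∀ y ∈ s, HasDerivAt f₁ (f₂ y) y := fun y hy ↦ by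
    have := (Real.hasDerivAt_rpow_const (p := α - 1) (x := y) (Or.inl (hspos y hy).2.2.ne')).const_mul α
    refine this.congr_deriv ?_
    rw [hf₂, show α - 1 - 1 = α - 2 by ring]
    ring
  have hd2 : ∀ y ∈ s, HasDerivAt f₂ (f₃ y) y := fun y hy ↦ by
    have := (Real.hasDerivAt_rpow_const (p := α - 2) (x := y) (Or.inl (hspos y hy).2.2.ne')).const_mul
      (α * (α - 1))
    refine this.congr_deriv ?_
    rw [hf₃, show α - 2 - 1 = α - 3 by ring]
    ring
  -- `|f₃| ≤ M` on `s`
  set M : ℝ := taylorK α d with hM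
  have hM0 : 0 ≤ M := taylorK_nonneg α hd
  have hf₃le : ∀ y ∈ s, |f₃ y| ≤ M := fun y hy ↦ by
    obtain ⟨hy1, hy2, hy0⟩ := hspos y hy
    rw [hf₃, hM, taylorK, abs_mul, abs_of_nonneg (Real.rpow_nonneg hy0.le _)]
    exact mul_le_mul_of_nonneg_left (rpow_le_endpoints hd hy1 hy2) (abs_nonneg _)
  -- mean value inequality three times
  have hΔ0 : ∀ y ∈ s, |y - d| ≤ |Δ| := fun y hy ↦ abs_sub_le_iff.2 ⟨by linarith [hy.2], by linarith [hy.1]⟩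
  have e3 : ∀ y ∈ s, |f₂ y - f₂ d| ≤ M * |Δ| := fun y hy ↦ by
    have := hsconv.norm_image_sub_le_of_norm_deriv_le (f := f₂) (C := M) (𝕜 := ℝ)
      (fun y hy ↦ (hd2 y hy).differentiableAt) (fun y hy ↦ by rw [(hd2 y hy).deriv]; exact hf₃le y hy) hds hy
    rw [Real.norm_eq_abs, Real.norm_eq_abs] at this
    exact this.trans (mul_le_mul_of_nonneg_left (hΔ0 y hy) hM0)
  have e2 : ∀ y ∈ s, |f₁ y - f₁ d - f₂ d * (y - d)| ≤ M * |Δ| ^ 2 := fun y hy ↦ by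
    have hG : ∀ w ∈ s, HasDerivAt (fun w ↦ f₁ w - f₂ d * (w - d)) (f₂ w - f₂ d) w := fun w hw ↦ by
      have := (hd1 w hw).sub (((hasDerivAt_id w).sub_const d).const_mul (f₂ d))
      rw [mul_one] at this
      exact this
    have := hsconv.norm_image_sub_le_of_norm_deriv_le (f := fun w ↦ f₁ w - f₂ d * (w - d)) (C := M * |Δ|)
      (𝕜 := ℝ) (fun w hw ↦ (hG w hw).differentiableAt) (fun w hw ↦ by
        rw [(hG w hw).deriv, Real.norm_eq_abs]; exact e3 w hw) hds hy
    rw [Real.norm_eq_abs, Real.norm_eq_abs, sub_self, mul_zero, sub_zero] at this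
    calc |f₁ y - f₁ d - f₂ d * (y - d)| = |f₁ y - f₂ d * (y - d) - f₁ d| := by ring_nf
      _ ≤ M * |Δ| * |y - d| := this
      _ ≤ M * |Δ| * |Δ| := mul_le_mul_of_nonneg_left (hΔ0 y hy) (by positivity)
      _ = M * |Δ| ^ 2 := by ring
  have hG : ∀ w ∈ s, HasDerivAt (fun w ↦ f w - f₁ d * (w - d) - f₂ d * (w - d) ^ 2 / 2)
      (f₁ w - f₁ d - f₂ d * (w - d)) w := fun w hw ↦ by
    have := ((hd0 w hw).sub (((hasDerivAt_id w).sub_const d).const_mul (f₁ d))).sub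
      (((((hasDerivAt_id w).sub_const d).pow 2).const_mul (f₂ d)).div_const 2)
    refine this.congr_deriv ?_
    simp only [id_eq, mul_one, Nat.cast_ofNat]
    ring
  have := hsconv.norm_image_sub_le_of_norm_deriv_le
    (f := fun w ↦ f w - f₁ d * (w - d) - f₂ d * (w - d) ^ 2 / 2) (C := M * |Δ| ^ 2) (𝕜 := ℝ)
    (fun w hw ↦ (hG w hw).differentiableAt) (fun w hw ↦ by
      rw [(hG w hw).deriv, Real.norm_eq_abs]; exact e2 w hw) hds hdΔs
  rw [Real.norm_eq_abs, Real.norm_eq_abs] at this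
  simp only [sub_self, mul_zero, ne_eq, OfNat.ofNat_ne_zero, not_false_eq_true, zero_pow, zero_div,
    sub_zero, add_sub_cancel_left] at this
  calc _ = |f (d + Δ) - f₁ d * Δ - f₂ d * Δ ^ 2 / 2 - f d| := by simp only [hf, hf₁, hf₂]; ring_nf
    _ ≤ M * |Δ| ^ 2 * |Δ| := this
    _ = M * |Δ| ^ 3 := by ring

namespace Loewner

/-! ### The linear model of the increment of `Y = d^α` -/

/-- **The linear model of the increment of `Y = d^α`**: with `f(y) = y^α`,
`f′(d)(c₂ x + c₃ x²/2 + u (c₂²/(2d) − (4/3)c₃)) + ½ f″(d) c₂² x²`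
(`f′(d) = α d^{α−1}`, `f″(d) = α(α−1) d^{α−2}`). Its mean over a Brownian increment `x`
(`E x = 0`, `E x² = κu`) is `u · driftCoeffK κ α d c₂ c₃` (`SLEBubblesSchwarzianMass`), the
drift of [LSW] (5.3). [cite: LawlerSchrammWerner2003Restriction, §5 (5.3) and Prop. 5.3] -/
def stepModelK (α d c₂ c₃ : ℝ) (u : ℝ≥0) (x : ℝ) : ℝ :=
  α * d ^ (α - 1) * (c₂ * x + c₃ * x ^ 2 / 2 + u * (c₂ ^ 2 / (2 * d) - 4 / 3 * c₃)) +
    1 / 2 * (α * (α - 1) * d ^ (α - 2)) * c₂ ^ 2 * x ^ 2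

/-- `stepModelK (5/8) = stepModel` (`StarHullOneStep`). [folklore] -/
theorem stepModelK_five_eighths (d c₂ c₃ : ℝ) (u : ℝ≥0) (x : ℝ) :
    stepModelK (5 / 8) d c₂ c₃ u x = stepModel d c₂ c₃ u x := by
  unfold stepModelK stepModel
  rw [show (5 / 8 : ℝ) - 1 = -(3 / 8) by norm_num, show (5 / 8 : ℝ) - 2 = -(11 / 8) by norm_num]
  ring

/-- The model is `(linear in x) + (…)(x² − κu) + u · drift`: replacing `x²` by `κ u` and dropping
the linear term gives `u` times the drift of [LSW] (5.3),
`α d^{α−1}[(κ/2) c₃ + c₂²/(2d) − (4/3) c₃] + ½ α(α−1) d^{α−2} κ c₂²` (`= driftCoeffK κ α d c₂ c₃`).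
[cite: LawlerSchrammWerner2003Restriction, §5 (5.3)] -/
theorem stepModelK_eq (α d c₂ c₃ : ℝ) (u : ℝ≥0) (x : ℝ) (κ : ℝ) :
    stepModelK α d c₂ c₃ u x =
      α * d ^ (α - 1) * c₂ * x +
        (α * d ^ (α - 1) * (c₃ / 2) + 1 / 2 * (α * (α - 1) * d ^ (α - 2)) * c₂ ^ 2) * (x ^ 2 - κ * u) +
        u * (α * d ^ (α - 1) * (κ / 2 * c₃ + c₂ ^ 2 / (2 * d) - 4 / 3 * c₃) +
          1 / 2 * (α * (α - 1) * d ^ (α - 2)) * κ * c₂ ^ 2) := by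
  rw [stepModelK]
  ring

/-! ### The expansion of `Y′ − Y`, real-variable form -/

/-- **The expansion of `Y′ − Y`, real-variable form, exponent `α > 0`**: if `|d′ − d − P| ≤ R`
for the model polynomial `P = c₂ x + c₃ x²/2 + u (c₂²/(2d) − (4/3)c₃)`, `|d′ − d| ≤ β ≤ d/2`,
`|x| ≤ η`, `|c₂| ≤ 1/ρ₀`, `|c₃| ≤ 2/ρ₀²`, then `Y′ − Y − stepModelK` is bounded by the Taylor
remainder `taylorK α d · β³`, plus `α d^{α−1} R`, plus the cross term
`(|α(α−1)| d^{α−2}/2)(2η²/ρ₀² + u(1/(dρ₀²) + 3/ρ₀²) + R)(β + η/ρ₀)` (as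
`abs_rpow_sub_stepModel_le_of` for `α = 5/8`). [folklore] -/
theorem abs_rpowK_sub_stepModelK_le_of {α d d' c₂ c₃ x η ρ₀ R β : ℝ} {u : ℝ≥0} (hα : 0 < α)
    (hd0 : 0 < d) (hρ₀ : 0 < ρ₀)
    (hx : |x| ≤ η) (hc2 : |c₂| ≤ 1 / ρ₀) (hc3 : |c₃| ≤ 2 / ρ₀ ^ 2)
    (hR : |d' - d - (c₂ * x + c₃ * x ^ 2 / 2 + u * (c₂ ^ 2 / (2 * d) - 4 / 3 * c₃))| ≤ R)
    (hβ : |d' - d| ≤ β) (hβd : β ≤ d / 2) :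
    |d' ^ α - d ^ α - stepModelK α d c₂ c₃ u x| ≤
      taylorK α d * β ^ 3 + α * d ^ (α - 1) * R +
        |α * (α - 1)| * d ^ (α - 2) / 2 *
          ((2 / ρ₀ ^ 2 * η ^ 2 + u * (1 / (d * ρ₀ ^ 2) + 3 / ρ₀ ^ 2) + R) * (β + η / ρ₀)) := by
  have hu0 : (0 : ℝ) ≤ u := u.coe_nonneg
  have hΔd : |d' - d| ≤ d / 2 := hβ.trans hβd
  -- Taylor of `y^α`
  have hT := abs_rpow_sub_taylor_le_gen α hd0 hΔd
  rw [add_sub_cancel] at hT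
  -- decomposition of the error: Taylor remainder + linear piece + quadratic cross term
  have hdecomp : d' ^ α - d ^ α - stepModelK α d c₂ c₃ u x =
      (d' ^ α - d ^ α - α * d ^ (α - 1) * (d' - d) - α * (α - 1) * d ^ (α - 2) * (d' - d) ^ 2 / 2) +
        α * d ^ (α - 1) * (d' - d - (c₂ * x + c₃ * x ^ 2 / 2 + u * (c₂ ^ 2 / (2 * d) - 4 / 3 * c₃))) +
        α * (α - 1) * d ^ (α - 2) / 2 * ((d' - d - c₂ * x) * (d' - d + c₂ * x)) := by
    rw [stepModelK]; ring
  rw [hdecomp]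
  -- bounds on the pieces (identical to the case `α = 5/8`)
  have hc2x : |c₂ * x| ≤ η / ρ₀ := by
    rw [abs_mul]
    calc |c₂| * |x| ≤ 1 / ρ₀ * η := mul_le_mul hc2 hx (abs_nonneg _) (by positivity)
      _ = η / ρ₀ := by ring
  have h3 : |c₃ * x ^ 2 / 2| ≤ 2 / ρ₀ ^ 2 * η ^ 2 := by
    rw [abs_div, abs_mul, abs_pow, abs_two]
    have hx2 : |x| ^ 2 ≤ η ^ 2 := pow_le_pow_left₀ (abs_nonneg _) hx 2
    have := mul_le_mul hc3 hx2 (by positivity) (by positivity)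
    have h' : 0 ≤ 2 / ρ₀ ^ 2 * η ^ 2 := by positivity
    linarith only [this, h']
  have h4a : |c₂ ^ 2 / (2 * d)| ≤ 1 / (d * ρ₀ ^ 2) := by
    rw [abs_div, abs_of_pos (by positivity : (0 : ℝ) < 2 * d), abs_of_nonneg (sq_nonneg _),
      div_le_div_iff₀ (by positivity) (by positivity)]
    have hc2' : c₂ ^ 2 ≤ (1 / ρ₀) ^ 2 := by
      rw [← sq_abs]; exact pow_le_pow_left₀ (abs_nonneg _) hc2 2
    have h5 : c₂ ^ 2 * (d * ρ₀ ^ 2) ≤ (1 / ρ₀) ^ 2 * (d * ρ₀ ^ 2) :=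
      mul_le_mul_of_nonneg_right hc2' (by positivity)
    have h' : (1 / ρ₀) ^ 2 * (d * ρ₀ ^ 2) = d := by field_simp
    have hd' : d ≤ 1 * (2 * d) := by linarith only [hd0]
    linarith only [h5, h', hd']
  have h4b : |4 / 3 * c₃| ≤ 3 / ρ₀ ^ 2 := by
    rw [abs_mul, show |(4 : ℝ) / 3| = 4 / 3 by norm_num]
    have := mul_le_mul_of_nonneg_left hc3 (by norm_num : (0 : ℝ) ≤ 4 / 3)
    have h' : 4 / 3 * (2 / ρ₀ ^ 2) ≤ 3 / ρ₀ ^ 2 := by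
      rw [← mul_div_assoc, div_le_div_iff_of_pos_right (by positivity)]
      norm_num
    linarith only [this, h']
  have h4 : |(u : ℝ) * (c₂ ^ 2 / (2 * d) - 4 / 3 * c₃)| ≤ u * (1 / (d * ρ₀ ^ 2) + 3 / ρ₀ ^ 2) := by
    rw [abs_mul, abs_of_nonneg hu0]
    exact mul_le_mul_of_nonneg_left ((abs_sub _ _).trans (add_le_add h4a h4b)) hu0
  have hPc : |c₃ * x ^ 2 / 2 + u * (c₂ ^ 2 / (2 * d) - 4 / 3 * c₃)| ≤
      2 / ρ₀ ^ 2 * η ^ 2 + u * (1 / (d * ρ₀ ^ 2) + 3 / ρ₀ ^ 2) := (abs_add_le _ _).trans (add_le_add h3 h4)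
  have hΔc : |d' - d - c₂ * x| ≤ 2 / ρ₀ ^ 2 * η ^ 2 + u * (1 / (d * ρ₀ ^ 2) + 3 / ρ₀ ^ 2) + R := by
    have h1 : d' - d - c₂ * x = (d' - d - (c₂ * x + c₃ * x ^ 2 / 2 + u * (c₂ ^ 2 / (2 * d) - 4 / 3 * c₃))) +
        (c₃ * x ^ 2 / 2 + u * (c₂ ^ 2 / (2 * d) - 4 / 3 * c₃)) := by ring
    rw [h1]
    have := abs_add_le (d' - d - (c₂ * x + c₃ * x ^ 2 / 2 + u * (c₂ ^ 2 / (2 * d) - 4 / 3 * c₃)))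
      (c₃ * x ^ 2 / 2 + u * (c₂ ^ 2 / (2 * d) - 4 / 3 * c₃))
    linarith only [this, hR, hPc]
  have hΔc' : |d' - d + c₂ * x| ≤ β + η / ρ₀ := (abs_add_le _ _).trans (add_le_add hβ hc2x)
  have hα1 : 0 ≤ α * d ^ (α - 1) := mul_nonneg hα.le (Real.rpow_nonneg hd0.le _)
  -- assemble: `|T + A + C| ≤ |T| + |A| + |C|`
  refine (abs_add_le _ _).trans (add_le_add ((abs_add_le _ _).trans (add_le_add ?_ ?_)) ?_)
  · exact hT.trans (mul_le_mul_of_nonneg_left (pow_le_pow_left₀ (abs_nonneg _) hβ 3) (taylorK_nonneg α hd0))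
  · rw [abs_mul, abs_of_nonneg hα1]
    exact mul_le_mul_of_nonneg_left hR hα1
  · rw [abs_mul, abs_mul, abs_div, abs_mul, abs_two, abs_of_nonneg (Real.rpow_nonneg hd0.le _)]
    have hR0 : 0 ≤ 2 / ρ₀ ^ 2 * η ^ 2 + u * (1 / (d * ρ₀ ^ 2) + 3 / ρ₀ ^ 2) + R :=
      (abs_nonneg _).trans hΔc
    exact mul_le_mul_of_nonneg_left (mul_le_mul hΔc hΔc' (abs_nonneg _) hR0) (by positivity)

/-! ### The ratio of the prefactors to those of the case `α = 5/8` -/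

/-- On `[δ₀, 1]` a real power is at most `δ₀^e + 1`. [folklore] -/
theorem rpow_le_rpow_add_one {δ₀ d e : ℝ} (hδ0 : 0 < δ₀) (hδ : δ₀ ≤ d) (hd1 : d ≤ 1) :
    d ^ e ≤ δ₀ ^ e + 1 := by
  have h1 : 0 ≤ δ₀ ^ e := Real.rpow_nonneg hδ0.le _
  rcases le_or_gt 0 e with he | he
  · have : d ^ e ≤ (1 : ℝ) ^ e := Real.rpow_le_rpow (by linarith) hd1 he
    rw [Real.one_rpow] at this
    linarith
  · have : d ^ e ≤ δ₀ ^ e := Real.rpow_le_rpow_of_nonpos hδ0 hδ he.le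
    linarith

/-- **The ratio constant** `ratioK α δ₀`: a common bound, for `δ₀ ≤ d ≤ 1`, of the three ratios
`taylorK α d / (d/2)^{−19/8}`, `α d^{α−1} / ((5/8) d^{−3/8})`, `(|α(α−1)| d^{α−2}/2) / ((15/128) d^{−11/8})`
of the prefactors of `abs_rpowK_sub_stepModelK_le_of` to those of the case `α = 5/8`
(all three are multiples of `d^{α − 5/8}`). [folklore] -/
def ratioK (α δ₀ : ℝ) : ℝ :=
  |α * (α - 1) * (α - 2)| * (1 + (3 : ℝ) ^ (α - 3)) * ((δ₀ / 2) ^ (α - 5 / 8) + 1) +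
    (8 * α / 5 + 64 * |α * (α - 1)| / 15) * (δ₀ ^ (α - 5 / 8) + 1)

/-- `0 ≤ ratioK α δ₀` for `α ≥ 0`, `δ₀ > 0`. [folklore] -/
theorem ratioK_nonneg {α δ₀ : ℝ} (hα : 0 ≤ α) (hδ0 : 0 < δ₀) : 0 ≤ ratioK α δ₀ := by
  unfold ratioK
  have h1 : 0 ≤ (3 : ℝ) ^ (α - 3) := Real.rpow_nonneg (by norm_num) _
  have h2 : 0 ≤ (δ₀ / 2) ^ (α - 5 / 8) := Real.rpow_nonneg (by positivity) _
  have h3 : 0 ≤ δ₀ ^ (α - 5 / 8) := Real.rpow_nonneg hδ0.le _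
  positivity

/-- **The three prefactors are at most `ratioK α δ₀` times those of the case `α = 5/8`**, for
`0 < α`, `0 < δ₀ ≤ d ≤ 1`. [folklore] -/
theorem ratioK_spec {α δ₀ d : ℝ} (hα : 0 < α) (hδ0 : 0 < δ₀) (hδ : δ₀ ≤ d) (hd1 : d ≤ 1) :
    taylorK α d ≤ ratioK α δ₀ * (d / 2) ^ (-(19 / 8 : ℝ)) ∧
      α * d ^ (α - 1) ≤ ratioK α δ₀ * (5 / 8 * d ^ (-(3 / 8 : ℝ))) ∧
      |α * (α - 1)| * d ^ (α - 2) / 2 ≤ ratioK α δ₀ * (15 / 128 * d ^ (-(11 / 8 : ℝ))) := by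
  have hd0 : 0 < d := hδ0.trans_le hδ
  -- the two powers `d^{α − 5/8}` and `(d/2)^{α − 5/8}` are at most `δ₀^… + 1`, `(δ₀/2)^… + 1`
  have hP : d ^ (α - 5 / 8) ≤ δ₀ ^ (α - 5 / 8) + 1 := rpow_le_rpow_add_one hδ0 hδ hd1
  have hP2 : (d / 2) ^ (α - 5 / 8) ≤ (δ₀ / 2) ^ (α - 5 / 8) + 1 :=
    rpow_le_rpow_add_one (by positivity) (by linarith) (by linarith)
  have hP0 : 0 ≤ d ^ (α - 5 / 8) := Real.rpow_nonneg hd0.le _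
  have hP20 : 0 ≤ (d / 2) ^ (α - 5 / 8) := Real.rpow_nonneg (by positivity) _
  -- nonnegativity of the parts of `ratioK`
  have n3 : 0 ≤ (3 : ℝ) ^ (α - 3) := Real.rpow_nonneg (by norm_num) _
  have nA : 0 ≤ |α * (α - 1) * (α - 2)| * (1 + (3 : ℝ) ^ (α - 3)) * ((δ₀ / 2) ^ (α - 5 / 8) + 1) := by
    have : 0 ≤ (δ₀ / 2) ^ (α - 5 / 8) := Real.rpow_nonneg (by positivity) _
    positivity
  have nB : 0 ≤ (8 * α / 5 + 64 * |α * (α - 1)| / 15) * (δ₀ ^ (α - 5 / 8) + 1) := by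
    have : 0 ≤ δ₀ ^ (α - 5 / 8) := Real.rpow_nonneg hδ0.le _
    positivity
  -- splitting of the powers
  have s1 : d ^ (α - 1) = d ^ (α - 5 / 8) * d ^ (-(3 / 8 : ℝ)) := by
    rw [← Real.rpow_add hd0]; congr 1; ring
  have s2 : d ^ (α - 2) = d ^ (α - 5 / 8) * d ^ (-(11 / 8 : ℝ)) := by
    rw [← Real.rpow_add hd0]; congr 1; ring
  have s3 : (d / 2) ^ (α - 3) = (d / 2) ^ (α - 5 / 8) * (d / 2) ^ (-(19 / 8 : ℝ)) := by
    rw [← Real.rpow_add (by positivity)]; congr 1; ring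
  have s4 : (3 * d / 2) ^ (α - 3) = (3 : ℝ) ^ (α - 3) * (d / 2) ^ (α - 3) := by
    rw [show 3 * d / 2 = 3 * (d / 2) by ring, Real.mul_rpow (by norm_num) (by positivity)]
  have hq0 : 0 ≤ (d / 2) ^ (-(19 / 8 : ℝ)) := Real.rpow_nonneg (by positivity) _
  have hq1 : 0 ≤ d ^ (-(3 / 8 : ℝ)) := Real.rpow_nonneg hd0.le _
  have hq2 : 0 ≤ d ^ (-(11 / 8 : ℝ)) := Real.rpow_nonneg hd0.le _
  refine ⟨?_, ?_, ?_⟩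
  · -- Taylor constant
    have e1 : taylorK α d =
        |α * (α - 1) * (α - 2)| * (1 + (3 : ℝ) ^ (α - 3)) * (d / 2) ^ (α - 5 / 8) * (d / 2) ^ (-(19 / 8 : ℝ)) := by
      rw [taylorK, s4, s3]; ring
    rw [e1, ratioK]
    have e2 : |α * (α - 1) * (α - 2)| * (1 + (3 : ℝ) ^ (α - 3)) * (d / 2) ^ (α - 5 / 8) ≤
        |α * (α - 1) * (α - 2)| * (1 + (3 : ℝ) ^ (α - 3)) * ((δ₀ / 2) ^ (α - 5 / 8) + 1) :=
      mul_le_mul_of_nonneg_left hP2 (by positivity)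
    have e3 := mul_le_mul_of_nonneg_right e2 hq0
    nlinarith only [e3, nB, hq0]
  · -- first derivative
    have e1 : α * d ^ (α - 1) = 8 * α / 5 * d ^ (α - 5 / 8) * (5 / 8 * d ^ (-(3 / 8 : ℝ))) := by
      rw [s1]; ring
    rw [e1, ratioK]
    have e2 : 8 * α / 5 * d ^ (α - 5 / 8) ≤ 8 * α / 5 * (δ₀ ^ (α - 5 / 8) + 1) :=
      mul_le_mul_of_nonneg_left hP (by positivity)
    have e4 : 8 * α / 5 * (δ₀ ^ (α - 5 / 8) + 1) ≤ (8 * α / 5 + 64 * |α * (α - 1)| / 15) * (δ₀ ^ (α - 5 / 8) + 1) := by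
      have : 0 ≤ δ₀ ^ (α - 5 / 8) + 1 := by have := Real.rpow_nonneg hδ0.le (α - 5 / 8); linarith
      apply mul_le_mul_of_nonneg_right _ this
      have : 0 ≤ 64 * |α * (α - 1)| / 15 := by positivity
      linarith
    have hq1' : 0 ≤ 5 / 8 * d ^ (-(3 / 8 : ℝ)) := by positivity
    have e3 := mul_le_mul_of_nonneg_right (e2.trans e4) hq1'
    nlinarith only [e3, nA, hq1']
  · -- second derivative
    have e1 : |α * (α - 1)| * d ^ (α - 2) / 2 =
        64 * |α * (α - 1)| / 15 * d ^ (α - 5 / 8) * (15 / 128 * d ^ (-(11 / 8 : ℝ))) := by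
      rw [s2]; ring
    rw [e1, ratioK]
    have e2 : 64 * |α * (α - 1)| / 15 * d ^ (α - 5 / 8) ≤ 64 * |α * (α - 1)| / 15 * (δ₀ ^ (α - 5 / 8) + 1) :=
      mul_le_mul_of_nonneg_left hP (by positivity)
    have e4 : 64 * |α * (α - 1)| / 15 * (δ₀ ^ (α - 5 / 8) + 1) ≤
        (8 * α / 5 + 64 * |α * (α - 1)| / 15) * (δ₀ ^ (α - 5 / 8) + 1) := by
      have : 0 ≤ δ₀ ^ (α - 5 / 8) + 1 := by have := Real.rpow_nonneg hδ0.le (α - 5 / 8); linarith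
      apply mul_le_mul_of_nonneg_right _ this
      have : 0 ≤ 8 * α / 5 := by positivity
      linarith
    have hq2' : 0 ≤ 15 / 128 * d ^ (-(11 / 8 : ℝ)) := by positivity
    have e3 := mul_le_mul_of_nonneg_right (e2.trans e4) hq2'
    nlinarith only [e3, nA, hq2']

/-! ### The expansion of `Y′ − Y` for one step of the flow, exponent `α > 0` -/

/-- **Crude bound**: `|d′^α − d^α| ≤ 1` for `α > 0`, both derivatives lying in `(0, 1]`.
[folklore] -/
theorem abs_rpowK_starDeriv_sub_le {α : ℝ} (hα : 0 < α) (B B' : Set ℂ) :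
    |starDeriv B' ^ α - starDeriv B ^ α| ≤ 1 := by
  -- `0 < starDeriv ≤ 1`, including the junk value `1` off `𝒬*`
  have hspec : ∀ C : Set ℂ, 0 < starDeriv C ∧ starDeriv C ≤ 1 := fun C ↦ by
    by_cases hC : IsStarHull C
    · exact ⟨(starDeriv_spec hC).1, (starDeriv_spec hC).2.1⟩
    · rw [starDeriv, dif_neg hC]; norm_num
  obtain ⟨h0, h1⟩ := hspec B
  obtain ⟨h0', h1'⟩ := hspec B'
  have a0 : 0 ≤ starDeriv B ^ α := Real.rpow_nonneg h0.le _
  have a1 : starDeriv B ^ α ≤ 1 := Real.rpow_le_one h0.le h1 hα.le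
  have b0 : 0 ≤ starDeriv B' ^ α := Real.rpow_nonneg h0'.le _
  have b1 : starDeriv B' ^ α ≤ 1 := Real.rpow_le_one h0'.le h1' hα.le
  rw [abs_le]
  constructor <;> linarith

variable {B : Set ℂ} {ρ₀ : ℝ} {U : ℝ≥0 → ℝ} {u : ℝ≥0} {S : ℝ}
variable (hB : IsStarHull B) (hU : Continuous U) (hU0 : U 0 = 0) (hu : 0 < u)
  (hS : ∀ v : ℝ≥0, v ≤ u → |U v| ≤ S) (hρ₀ : 0 < ρ₀) (hBρ : Disjoint (ball (0 : ℂ) (8 * ρ₀)) B)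
  (hη : stepSize S u ≤ starDeriv B * ρ₀ / 1000)

include hB hU hU0 hu hS hρ₀ hBρ hη in
/-- **The clean one-step bound, exponent `α > 0`**: for hulls with `δ₀ ≤ Φ′_B(0)`, missing
`ball 0 (8ρ₀)`, `ρ₀ ≤ 1`, and steps with `u ≤ 1`, `η = stepSize S u ≤ 1`:

  `|Y′ − Y − stepModelK α d c₂ c₃ u x| ≤ ratioK α δ₀ · stepKcleanOf δ₀ (stepK δ₀ ρ₀) · (u η + u² + |x|³ + u |x|)`,

`x = U_u`, `Y = Φ′_B(0)^α`, `Y′ = Φ′_{B′}(0)^α` (the bounds on `d′ − d` are those of the case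
`α = 5/8`, `abs_rpow_sub_stepModel_le_clean`; the prefactors are compared by `ratioK_spec`, and the
algebraic domination `stepModel_rhs_le` is applied verbatim).
[cite: LawlerSchrammWerner2003Restriction, §5 (5.3) and Prop. 5.3] -/
theorem abs_rpowK_sub_stepModelK_le_clean {α : ℝ} (hα : 0 < α) (hρ1 : ρ₀ ≤ 1) {δ₀ : ℝ} (hδ0 : 0 < δ₀)
    (hδ : δ₀ ≤ starDeriv B) (hη1 : stepSize S u ≤ 1) (hu1 : (u : ℝ) ≤ 1) :
    |starDeriv (slidHull U B u) ^ α - starDeriv B ^ α -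
        stepModelK α (starDeriv B) (starJet2 B) (starJet3 B) u (U u)| ≤
      ratioK α δ₀ * stepKcleanOf δ₀ (stepK δ₀ ρ₀) * (u * stepSize S u + u ^ 2 + |U u| ^ 3 + u * |U u|) := by
  obtain ⟨hUu, -, hη0⟩ := abs_driver_le hB hu hS hρ₀ hη
  obtain ⟨hd0, hd1, -⟩ := starDeriv_spec hB
  have hδ1 : δ₀ ≤ 1 := hδ.trans hd1
  obtain ⟨-, -, hc2, hc3, -⟩ := starJet_spec hB hρ₀ hBρ
  obtain ⟨hK1, hKρ, hK2, hK4, hK8, hK6144, hK12⟩ := stepK_spec hδ0 hδ1 hρ₀ hρ1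
  have hmain := abs_starDeriv_sub_model_le hB hU hU0 hu hS hρ₀ hBρ hη
  obtain ⟨hcrude, hsmall⟩ := abs_starDeriv_sub_le_crude hB hU hU0 hu hS hρ₀ hBρ hη
  have ha0 : 0 ≤ |U u| := abs_nonneg _
  have hu0 : (0 : ℝ) ≤ u := u.coe_nonneg
  have hK0 : 0 ≤ stepK δ₀ ρ₀ := by linarith only [hK1]
  have hdpos : 0 < starDeriv B := hd0
  -- (1) `R ≤ K r`
  have hR0 : 0 ≤ 200000 * u * (stepSize S u * ρ₀ + u) / (starDeriv B * ρ₀ ^ 4) + 8 / ρ₀ ^ 3 * |U u| ^ 3 +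
      6144 / ρ₀ ^ 3 * u * |U u| := by positivity
  have hRK : 200000 * u * (stepSize S u * ρ₀ + u) / (starDeriv B * ρ₀ ^ 4) + 8 / ρ₀ ^ 3 * |U u| ^ 3 +
      6144 / ρ₀ ^ 3 * u * |U u| ≤
      stepK δ₀ ρ₀ * (u * stepSize S u + u ^ 2 + |U u| ^ 3 + u * |U u|) := by
    have e1 : 200000 * u * (stepSize S u * ρ₀ + u) / (starDeriv B * ρ₀ ^ 4) ≤ stepK δ₀ ρ₀ * (u * stepSize S u + u ^ 2) := by
      rw [stepK, div_mul_eq_mul_div, div_le_div_iff₀ (by positivity) (by positivity)]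
      have h2 : (u : ℝ) * (stepSize S u * ρ₀ + u) ≤ u * stepSize S u + u ^ 2 := by
        have : stepSize S u * ρ₀ ≤ stepSize S u := mul_le_of_le_one_right hη0.le hρ1
        nlinarith only [this, hu0]
      have h3 : δ₀ * ρ₀ ^ 4 ≤ starDeriv B * ρ₀ ^ 4 := mul_le_mul_of_nonneg_right hδ (by positivity)
      have h4 := mul_le_mul h2 h3 (by positivity) (by positivity)
      nlinarith only [h4]
    have e2 : 8 / ρ₀ ^ 3 * |U u| ^ 3 ≤ stepK δ₀ ρ₀ * |U u| ^ 3 := mul_le_mul_of_nonneg_right hK8 (by positivity)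
    have e3 : 6144 / ρ₀ ^ 3 * u * |U u| ≤ stepK δ₀ ρ₀ * (u * |U u|) := by
      rw [mul_assoc]; exact mul_le_mul_of_nonneg_right hK6144 (by positivity)
    have e4 : stepK δ₀ ρ₀ * (u * stepSize S u + u ^ 2) + stepK δ₀ ρ₀ * |U u| ^ 3 + stepK δ₀ ρ₀ * (u * |U u|) =
        stepK δ₀ ρ₀ * (u * stepSize S u + u ^ 2 + |U u| ^ 3 + u * |U u|) := by ring
    linarith only [e1, e2, e3, e4]
  -- (2) `|P| ≤ K (a + u)` and `β := min (|P| + R) (d/2)`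
  have hP : |starJet2 B * U u + starJet3 B * U u ^ 2 / 2 + u * (starJet2 B ^ 2 / (2 * starDeriv B) - 4 / 3 * starJet3 B)| ≤
      stepK δ₀ ρ₀ * (|U u| + u) := by
    have e1 : |starJet2 B * U u| ≤ 1 / ρ₀ * |U u| := by
      rw [abs_mul]; exact mul_le_mul_of_nonneg_right hc2 ha0
    have e2 : |starJet3 B * U u ^ 2 / 2| ≤ 1 / ρ₀ ^ 2 * |U u| := by
      rw [abs_div, abs_mul, abs_pow, abs_two]
      have hx2 : |U u| ^ 2 ≤ |U u| := by
        have : |U u| ≤ 1 := hUu.trans hη1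
        nlinarith only [this, ha0]
      have h' := mul_le_mul hc3 hx2 (by positivity) (by positivity)
      have h'' : 2 / ρ₀ ^ 2 * |U u| / 2 = 1 / ρ₀ ^ 2 * |U u| := by ring
      rw [← h'']
      exact div_le_div_of_nonneg_right h' (by norm_num)
    have e3 : |(u : ℝ) * (starJet2 B ^ 2 / (2 * starDeriv B) - 4 / 3 * starJet3 B)| ≤ 4 / (δ₀ * ρ₀ ^ 2) * u := by
      rw [abs_mul, abs_of_nonneg hu0, mul_comm]
      refine mul_le_mul_of_nonneg_right ((abs_sub _ _).trans ?_) hu0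
      have f1 : |starJet2 B ^ 2 / (2 * starDeriv B)| ≤ 1 / (δ₀ * ρ₀ ^ 2) := by
        rw [abs_div, abs_of_pos (by positivity : (0:ℝ) < 2 * starDeriv B), abs_of_nonneg (sq_nonneg _),
          div_le_div_iff₀ (by positivity) (by positivity)]
        have g1 : starJet2 B ^ 2 ≤ (1 / ρ₀) ^ 2 := by rw [← sq_abs]; exact pow_le_pow_left₀ (abs_nonneg _) hc2 2
        have g2 : starJet2 B ^ 2 * (δ₀ * ρ₀ ^ 2) ≤ (1 / ρ₀) ^ 2 * (δ₀ * ρ₀ ^ 2) := mul_le_mul_of_nonneg_right g1 (by positivity)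
        have g3 : (1 / ρ₀) ^ 2 * (δ₀ * ρ₀ ^ 2) = δ₀ := by field_simp
        have g4 : δ₀ ≤ 1 * (2 * starDeriv B) := by linarith only [hδ, hd0]
        linarith only [g2, g3, g4]
      have f2 : |4 / 3 * starJet3 B| ≤ 3 / (δ₀ * ρ₀ ^ 2) := by
        rw [abs_mul, show |(4:ℝ) / 3| = 4 / 3 by norm_num]
        have g1 := mul_le_mul_of_nonneg_left hc3 (by norm_num : (0:ℝ) ≤ 4 / 3)
        have g2 : 4 / 3 * (2 / ρ₀ ^ 2) ≤ 3 / (δ₀ * ρ₀ ^ 2) := by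
          rw [← mul_div_assoc, div_le_div_iff₀ (by positivity) (by positivity)]
          have : δ₀ * ρ₀ ^ 2 ≤ ρ₀ ^ 2 := mul_le_of_le_one_left (by positivity) hδ1
          nlinarith only [this, pow_pos hρ₀ 2]
        linarith only [g1, g2]
      have f3 : 1 / (δ₀ * ρ₀ ^ 2) + 3 / (δ₀ * ρ₀ ^ 2) = 4 / (δ₀ * ρ₀ ^ 2) := by ring
      linarith only [f1, f2, f3]
    have e4 := abs_add_three (starJet2 B * U u) (starJet3 B * U u ^ 2 / 2)
      ((u : ℝ) * (starJet2 B ^ 2 / (2 * starDeriv B) - 4 / 3 * starJet3 B))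
    have e5 : (1 / ρ₀ + 1 / ρ₀ ^ 2) * |U u| ≤ stepK δ₀ ρ₀ * |U u| := mul_le_mul_of_nonneg_right hK12 ha0
    have e6 : 4 / (δ₀ * ρ₀ ^ 2) * u ≤ stepK δ₀ ρ₀ * u := mul_le_mul_of_nonneg_right hK4 hu0
    have e7 : (1 / ρ₀ + 1 / ρ₀ ^ 2) * |U u| = 1 / ρ₀ * |U u| + 1 / ρ₀ ^ 2 * |U u| := by ring
    have e8 : stepK δ₀ ρ₀ * (|U u| + u) = stepK δ₀ ρ₀ * |U u| + stepK δ₀ ρ₀ * u := by ring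
    linarith only [e1, e2, e3, e4, e5, e6, e7, e8]
  have hβ : |starDeriv (slidHull U B u) - starDeriv B| ≤
      stepK δ₀ ρ₀ * (|U u| + u + (u * stepSize S u + u ^ 2 + |U u| ^ 3 + u * |U u|)) := by
    have h1 := abs_sub_abs_le_abs_sub (starDeriv (slidHull U B u) - starDeriv B)
      (starJet2 B * U u + starJet3 B * U u ^ 2 / 2 + u * (starJet2 B ^ 2 / (2 * starDeriv B) - 4 / 3 * starJet3 B))
    have h2 : stepK δ₀ ρ₀ * (|U u| + u + (u * stepSize S u + u ^ 2 + |U u| ^ 3 + u * |U u|)) =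
        stepK δ₀ ρ₀ * (|U u| + u) + stepK δ₀ ρ₀ * (u * stepSize S u + u ^ 2 + |U u| ^ 3 + u * |U u|) := by ring
    linarith only [h1, hmain, hRK, hP, h2]
  have hβd : |starDeriv (slidHull U B u) - starDeriv B| ≤ starDeriv B / 2 := by linarith only [hcrude, hsmall, hd0]
  -- (3) the real-variable lemma with `η := |x|` and `β := min (K s) (d/2)`
  have key := abs_rpowK_sub_stepModelK_le_of (u := u) hα hd0 hρ₀ (le_refl |U u|) hc2 hc3 hmain
    (β := min (stepK δ₀ ρ₀ * (|U u| + u + (u * stepSize S u + u ^ 2 + |U u| ^ 3 + u * |U u|))) (starDeriv B / 2))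
    (le_min hβ hβd) (min_le_right _ _)
  -- (4) the pieces
  have hI0 : 0 ≤ 2 / ρ₀ ^ 2 * |U u| ^ 2 + u * (1 / (starDeriv B * ρ₀ ^ 2) + 3 / ρ₀ ^ 2) +
      (200000 * u * (stepSize S u * ρ₀ + u) / (starDeriv B * ρ₀ ^ 4) + 8 / ρ₀ ^ 3 * |U u| ^ 3 +
        6144 / ρ₀ ^ 3 * u * |U u|) := by positivity
  have hI : 2 / ρ₀ ^ 2 * |U u| ^ 2 + u * (1 / (starDeriv B * ρ₀ ^ 2) + 3 / ρ₀ ^ 2) +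
      (200000 * u * (stepSize S u * ρ₀ + u) / (starDeriv B * ρ₀ ^ 4) + 8 / ρ₀ ^ 3 * |U u| ^ 3 +
        6144 / ρ₀ ^ 3 * u * |U u|) ≤
      stepK δ₀ ρ₀ * (|U u| ^ 2 + u + (u * stepSize S u + u ^ 2 + |U u| ^ 3 + u * |U u|)) := by
    have e1 : 2 / ρ₀ ^ 2 * |U u| ^ 2 ≤ stepK δ₀ ρ₀ * |U u| ^ 2 := mul_le_mul_of_nonneg_right hK2 (by positivity)
    have e2 : (u : ℝ) * (1 / (starDeriv B * ρ₀ ^ 2) + 3 / ρ₀ ^ 2) ≤ stepK δ₀ ρ₀ * u := by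
      rw [mul_comm]
      refine mul_le_mul_of_nonneg_right ?_ hu0
      have f1 : 1 / (starDeriv B * ρ₀ ^ 2) ≤ 1 / (δ₀ * ρ₀ ^ 2) :=
        one_div_le_one_div_of_le (by positivity) (mul_le_mul_of_nonneg_right hδ (by positivity))
      have f2 : 1 / (δ₀ * ρ₀ ^ 2) + 3 / ρ₀ ^ 2 ≤ 4 / (δ₀ * ρ₀ ^ 2) := by
        have : 3 / ρ₀ ^ 2 ≤ 3 / (δ₀ * ρ₀ ^ 2) :=
          div_le_div_of_nonneg_left (by norm_num) (by positivity) (mul_le_of_le_one_left (by positivity) hδ1)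
        have f3 : 1 / (δ₀ * ρ₀ ^ 2) + 3 / (δ₀ * ρ₀ ^ 2) = 4 / (δ₀ * ρ₀ ^ 2) := by ring
        linarith only [this, f3]
      linarith only [f1, f2, hK4]
    have e3 : stepK δ₀ ρ₀ * (|U u| ^ 2 + u + (u * stepSize S u + u ^ 2 + |U u| ^ 3 + u * |U u|)) =
        stepK δ₀ ρ₀ * |U u| ^ 2 + stepK δ₀ ρ₀ * u + stepK δ₀ ρ₀ * (u * stepSize S u + u ^ 2 + |U u| ^ 3 + u * |U u|) := by
      ring
    linarith only [e1, e2, e3, hRK]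
  set β' := min (stepK δ₀ ρ₀ * (|U u| + u + (u * stepSize S u + u ^ 2 + |U u| ^ 3 + u * |U u|))) (starDeriv B / 2)
    with hβ'
  set I := 2 / ρ₀ ^ 2 * |U u| ^ 2 + u * (1 / (starDeriv B * ρ₀ ^ 2) + 3 / ρ₀ ^ 2) +
      (200000 * u * (stepSize S u * ρ₀ + u) / (starDeriv B * ρ₀ ^ 4) + 8 / ρ₀ ^ 3 * |U u| ^ 3 +
        6144 / ρ₀ ^ 3 * u * |U u|) with hIdef
  set R := 200000 * u * (stepSize S u * ρ₀ + u) / (starDeriv B * ρ₀ ^ 4) + 8 / ρ₀ ^ 3 * |U u| ^ 3 +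
      6144 / ρ₀ ^ 3 * u * |U u| with hRdef
  have hKa : β' + |U u| / ρ₀ ≤ β' + stepK δ₀ ρ₀ * |U u| := by
    have : |U u| / ρ₀ = 1 / ρ₀ * |U u| := by ring
    rw [this]; exact add_le_add le_rfl (mul_le_mul_of_nonneg_right hKρ ha0)
  have hβ0 : 0 ≤ β' := le_min (by positivity) (by positivity)
  have hβa0 : 0 ≤ β' + |U u| / ρ₀ := by positivity
  -- (5) comparison of the prefactors with the case `α = 5/8`
  obtain ⟨r1, r2, r3⟩ := ratioK_spec hα hδ0 hδ hd1
  have hL0 : 0 ≤ ratioK α δ₀ := ratioK_nonneg hα.le hδ0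
  have hT0 : 0 ≤ (starDeriv B / 2) ^ (-(19 / 8 : ℝ)) := Real.rpow_nonneg (by positivity) _
  have hd38 : 0 ≤ 5 / 8 * starDeriv B ^ (-(3 / 8 : ℝ)) := by positivity
  have hd118 : 0 ≤ 15 / 128 * starDeriv B ^ (-(11 / 8 : ℝ)) := by positivity
  have q1 : taylorK α (starDeriv B) * β' ^ 3 ≤ ratioK α δ₀ * ((starDeriv B / 2) ^ (-(19 / 8 : ℝ)) * β' ^ 3) := by
    rw [← mul_assoc]; exact mul_le_mul_of_nonneg_right r1 (by positivity)
  have q2 : α * starDeriv B ^ (α - 1) * R ≤ ratioK α δ₀ * (5 / 8 * starDeriv B ^ (-(3 / 8 : ℝ)) * R) := by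
    rw [← mul_assoc]; exact mul_le_mul_of_nonneg_right r2 hR0
  have q3 : |α * (α - 1)| * starDeriv B ^ (α - 2) / 2 * (I * (β' + |U u| / ρ₀)) ≤
      ratioK α δ₀ * (15 / 128 * starDeriv B ^ (-(11 / 8 : ℝ)) * (I * (β' + stepK δ₀ ρ₀ * |U u|))) := by
    have hmono : I * (β' + |U u| / ρ₀) ≤ I * (β' + stepK δ₀ ρ₀ * |U u|) := mul_le_mul_of_nonneg_left hKa hI0
    calc |α * (α - 1)| * starDeriv B ^ (α - 2) / 2 * (I * (β' + |U u| / ρ₀))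
        ≤ |α * (α - 1)| * starDeriv B ^ (α - 2) / 2 * (I * (β' + stepK δ₀ ρ₀ * |U u|)) :=
          mul_le_mul_of_nonneg_left hmono (by positivity)
      _ ≤ ratioK α δ₀ * (15 / 128 * starDeriv B ^ (-(11 / 8 : ℝ))) * (I * (β' + stepK δ₀ ρ₀ * |U u|)) :=
          mul_le_mul_of_nonneg_right r3 (by positivity)
      _ = _ := by ring
  have pure := stepModel_rhs_le (d := starDeriv B) hK1 ha0 hu0 hu1 hη0.le hη1 hUu hR0 hRK hβ0 (min_le_left _ _)
    hI0 hI hδ0 hδ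
  have pure' := mul_le_mul_of_nonneg_left pure hL0
  have hsum : ratioK α δ₀ * ((starDeriv B / 2) ^ (-(19 / 8 : ℝ)) * β' ^ 3) +
      ratioK α δ₀ * (5 / 8 * starDeriv B ^ (-(3 / 8 : ℝ)) * R) +
      ratioK α δ₀ * (15 / 128 * starDeriv B ^ (-(11 / 8 : ℝ)) * (I * (β' + stepK δ₀ ρ₀ * |U u|))) =
      ratioK α δ₀ * ((starDeriv B / 2) ^ (-(19 / 8 : ℝ)) * β' ^ 3 + 5 / 8 * starDeriv B ^ (-(3 / 8 : ℝ)) * R +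
        15 / 128 * starDeriv B ^ (-(11 / 8 : ℝ)) * (I * (β' + stepK δ₀ ρ₀ * |U u|))) := by ring
  calc _ ≤ taylorK α (starDeriv B) * β' ^ 3 + α * starDeriv B ^ (α - 1) * R +
        |α * (α - 1)| * starDeriv B ^ (α - 2) / 2 * (I * (β' + |U u| / ρ₀)) := key
    _ ≤ ratioK α δ₀ * ((starDeriv B / 2) ^ (-(19 / 8 : ℝ)) * β' ^ 3 + 5 / 8 * starDeriv B ^ (-(3 / 8 : ℝ)) * R +
        15 / 128 * starDeriv B ^ (-(11 / 8 : ℝ)) * (I * (β' + stepK δ₀ ρ₀ * |U u|))) := by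
          rw [← hsum]; linarith only [q1, q2, q3]
    _ ≤ ratioK α δ₀ * (stepKcleanOf δ₀ (stepK δ₀ ρ₀) * (u * stepSize S u + u ^ 2 + |U u| ^ 3 + u * |U u|)) := pure'
    _ = _ := by ring

end Loewner

end Literature.Probability.RandomPlanarGeometry

end
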